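import Summits.BirchSwinnertonDyer.Rank1Residual.Supersingular.KobayashiMainConjecture
import Summits.BirchSwinnertonDyer.Rank1Residual.P2.EmptyCellsAtTwo
import Literature.NumberTheory.EllipticCurves.ModularCurvePeriodRatio
import HarnessLib

/-!
# Route `ThetaPartnerAtTwo`, crux K2 `SignedMainConjectureCMTwo` (item stmt-BirchSwinnertonDyer-20307):
# the PERIOD-RATIO half of the analytic stub is a citation — `ϖ = Ω⁺_f/Ω_E` is a `2`-adic unit at a
# good prime `2` with `E[2]` irreducible (Abbes–Ullmo / Greenberg–Vatsal / Edixhoven)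

HONEST FRAMING (cell `pub/bsd-wall`, W-ALL row 1, prover seat `bsd-wall-tp2-p2`, successor g1): the
registered stub `stub_analyticMuCMTwo` of the crux's skeleton line `rankzero` asks, for a CM curve
`A/ℚ` good supersingular at `2` with `a₂ = 0` and analytic rank `0`, for every newform `f` of `A`,
period ratio `ϖ` (`ϖ·Ω_A = Ω⁺_f`) and Pollack pair at `2`: (i) `ord₂ ϖ = 0` AND (ii) some coefficient
of Kobayashi's `L⁺ = L♭` is a `2`-adic unit (analytic `μ = 0`). Part (i) is IN PRINT: it is the `p = 2`
reading of the tree's named fact `realPeriodRat_eq_unit_mul_plusPeriod` (Greenberg–Vatsal 2000 §3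
Rem. 3.4 chain, landed for `p ≥ 5`), where the only prime-sensitive step — "`p ∤ c₀` for the Manin
constant `c₀` of the strong Weil curve" — is supplied at EVERY prime `p ∤ N` by Abbes–Ullmo 1996
Thm. A ("if `p ∣ c_E` then `p ∣ N`", as quoted in Agashe–Ribet–Stein, PAMQ 2 (2006) Thm. 2.5); the
other two steps (Edixhoven 1991 Prop. 2: `Λ(ω_{E₀}) = c₀Λ_f`; no curve of the isogeny class has a
rational `p`-isogeny when `E[p]` is irreducible, so all scalings are prime to `p`) carry no parity
condition, and the real-period normalisations (`Ω(E) = ∫_{E(ℝ)}|ω|`, `re Λ_f = ℤ·Ω⁺_f/2`) agree with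
no stray factor `2` (rectangular: `Ω(E₀) = 2Ω₀ = c₀Ω⁺_f`; rhombic: `Ω(E₀) = Ω₀ = c₀Ω⁺_f`). That `p = 2`
reading is the tree's named fact `Literature.NumberTheory.EllipticCurves.realPeriodRat_eq_unit_mul_plusPeriod_two`
(`ModularCurvePeriodRatio.lean`, filed by this seat); this file proves:
* `padicValRat_periodRatio_eq_zero_two` — granted the fact: for `W` good supersingular at `2` (so
  `W[2]` irreducible, `P2.irr_two_of_goodSS_two`) and any newform `f` of `W` with `ϖ·Ω_W = Ω⁺_f`,
  `ord₂ ϖ = 0`;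
* `analyticMuCMTwo_of_flat` — hence the registered stub `stub_analyticMuCMTwo` REDUCES to its half
  (ii), the genuinely analytic statement "`L♭_A` has a unit coefficient" (Kurihara–Otsuki 2006
  Rem. 0.2(3) for `X₀(27)`: `f = L♭·unit` with `f(0) = L(E,1)/Ω_E` odd; unprinted class-wide).
Nothing about any curve is asserted beyond the displayed binders (the fact enters BY NAME as `h2`).

References: [AbbesUllmo1996] Thm. A; [GreenbergVatsal2000] §3 Rem. 3.4; [EdixhovenManin1991] Prop. 2;
[AgasheRibetStein2006] Thm. 2.5; [KuriharaOtsuki2006] Rem. 0.2 (3); [Kobayashi2003] (3.6).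
-/

set_option autoImplicit false
-- the Theorems namespace of this sub repeats the summit name by design (D-0017 nested layout)
set_option linter.dupNamespace false

noncomputable section

open scoped Classical MatrixGroups ModularForm

open CongruenceSubgroup WeierstrassCurve Literature.NumberTheory.EllipticCurves
  Literature.NumberTheory.EllipticCurves.ModularForms
  Literature.NumberTheory.EllipticCurves.Rank1Residual
  Literature.NumberTheory.EllipticCurves.Kobayashi2003 ZpExtension
  Summit.BirchSwinnertonDyer.Rank1Residual Summit.BirchSwinnertonDyer.Rank1Residual.Supersingular

namespace Summit.BirchSwinnertonDyer.BirchSwinnertonDyer.Theorems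

variable (A : WeierstrassCurve ℚ) [A.IsElliptic] [A.IsGloballyMinimal]

/-- **`ord₂ ϖ = 0` for the period ratio at a good supersingular `2`.** Granted the named fact
`realPeriodRat_eq_unit_mul_plusPeriod_two` (`h2`): for `W` good supersingular at `2` (hence `W[2]`
irreducible, `P2.irr_two_of_goodSS_two`), a newform `f` of `W` and `ϖ ∈ ℚ` with `ϖ·Ω_W = Ω⁺_f`,
`ϖ = u⁻¹` is a `2`-adic unit: `padicValRat 2 ϖ = 0`. [cite: GreenbergVatsal2000, §3, Remark 3.4]
[cite: AbbesUllmo1996, Thm. A] -/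
theorem padicValRat_periodRatio_eq_zero_two (h2 : Literature.NumberTheory.EllipticCurves.realPeriodRat_eq_unit_mul_plusPeriod_two)
    (hss : GoodSS A 2) {N : ℕ} [NeZero N] {f : CuspForm (Gamma0 N) 2} (hf : IsNewformOf A f)
    {ϖ : ℚ} (hϖ : (ϖ : ℝ) * A.realPeriodRat = plusPeriod f) : padicValRat 2 ϖ = 0 := by
  obtain ⟨u, hu1, hΩ⟩ := h2 A hss.1 (P2.irr_two_of_goodSS_two A hss) f hf
  have hΩpos : 0 < A.realPeriodRat := A.realPeriodRat_pos_holds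
  have hu0 : u ≠ 0 := by
    rintro rfl
    rw [Rat.cast_zero, zero_mul] at hΩ
    exact hΩpos.ne' hΩ
  have hP0 : plusPeriod f ≠ 0 := by
    intro h0
    rw [h0, mul_zero] at hΩ
    exact hΩpos.ne' hΩ
  -- `ϖ · u · Ω⁺_f = Ω⁺_f`, so `ϖ · u = 1`
  have hϖu : ((ϖ * u : ℚ) : ℝ) = 1 := by
    have h : (ϖ : ℝ) * ((u : ℝ) * plusPeriod f) = 1 * plusPeriod f := by rw [← hΩ, hϖ, one_mul]
    rw [← mul_assoc] at h
    have h' := mul_right_cancel₀ hP0 h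
    exact_mod_cast h'
  have hϖu' : ϖ * u = 1 := by exact_mod_cast hϖu
  have hϖ0 : ϖ ≠ 0 := left_ne_zero_of_mul_eq_one hϖu'
  have hϖQ : (ϖ : ℚ_[2]) ≠ 0 := by exact_mod_cast hϖ0
  -- norms in `ℚ₂`: `|ϖ|·|u| = 1`, `|u| = 1`
  have hnorm : ‖(ϖ : ℚ_[2])‖ = 1 := by
    have h : ‖((ϖ * u : ℚ) : ℚ_[2])‖ = 1 := by rw [hϖu']; simp
    rw [Rat.cast_mul, norm_mul, hu1, mul_one] at h
    exact h
  have hval := Padic.norm_eq_zpow_neg_valuation hϖQ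
  rw [hnorm, Padic.valuation_ratCast] at hval
  -- `1 = 2 ^ (-v)` forces `v = 0`
  have h2' : (1 : ℝ) < 2 := by norm_num
  have hz : (-padicValRat 2 ϖ : ℤ) = 0 := by
    by_contra hne
    rcases lt_or_gt_of_ne hne with hlt | hgt
    · have := zpow_lt_one_of_neg₀ h2' hlt
      exact absurd hval.symm (ne_of_lt (by exact_mod_cast this))
    · have := one_lt_zpow₀ h2' hgt
      exact absurd hval (ne_of_lt (by exact_mod_cast this))
  omega

/-- **The analytic stub of line `rankzero` reduces to its `L♭`-half.** Granted the named fact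
`realPeriodRat_eq_unit_mul_plusPeriod_two` (PUB, by name), the registered stub `stub_analyticMuCMTwo`
(for CM `A` good supersingular at `2`, `a₂ = 0`, analytic rank `0`: `ord₂ ϖ = 0 ∧ L⁺ = L♭` has a unit
coefficient, for every newform/period/Pollack datum) follows from its second conjunct alone (`hflat`,
the analytic `μ(L♭_A) = 0`, unprinted class-wide; Kurihara–Otsuki 2006 Rem. 0.2(3) for `X₀(27)`).
Nothing asserted beyond the binders. [cite: KuriharaOtsuki2006, Rem. 0.2 (3)] [cite: AbbesUllmo1996, Thm. A] -/
theorem analyticMuCMTwo_of_flat (h2 : Literature.NumberTheory.EllipticCurves.realPeriodRat_eq_unit_mul_plusPeriod_two)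
    (hflat : ∀ (A : WeierstrassCurve ℚ) [A.IsElliptic] [A.IsGloballyMinimal],
      A.HasCM → A.analyticRank = 0 → GoodSS A 2 → A.frobeniusTrace 2 = 0 →
      ∀ [NeZero (A.conductorNorm ℤ)] (f : CuspForm (Gamma0 (A.conductorNorm ℤ)) 2),
      IsNewformOf A f → ∀ (Lplus Lminus : IwasawaAlgebra 2), IsPollackPair f 2 Lplus Lminus →
        ∃ n : ℕ, IsUnit (PowerSeries.coeff n (kobayashiL 1 Lplus Lminus))) :
    ∀ (A : WeierstrassCurve ℚ) [A.IsElliptic] [A.IsGloballyMinimal],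
      A.HasCM → A.analyticRank = 0 → GoodSS A 2 → A.frobeniusTrace 2 = 0 →
      ∀ [NeZero (A.conductorNorm ℤ)] (f : CuspForm (Gamma0 (A.conductorNorm ℤ)) 2),
      IsNewformOf A f → ∀ (ϖ : ℚ), (ϖ : ℝ) * A.realPeriodRat = plusPeriod f →
      ∀ (Lplus Lminus : IwasawaAlgebra 2), IsPollackPair f 2 Lplus Lminus →
        padicValRat 2 ϖ = 0 ∧ ∃ n : ℕ, IsUnit (PowerSeries.coeff n (kobayashiL 1 Lplus Lminus)) :=
  fun A _ _ hcm hr hss ha _ f hf _ hϖ Lplus Lminus hPP =>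
    ⟨padicValRat_periodRatio_eq_zero_two A h2 hss hf hϖ, hflat A hcm hr hss ha f hf Lplus Lminus hPP⟩

end Summit.BirchSwinnertonDyer.BirchSwinnertonDyer.Theorems

end
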